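import Summits.NavierStokesRegularity.NavierStokesRegularity.Theses.SelfMixingDichotomy
import Summits.NavierStokesRegularity.NavierStokesRegularity.Theorems.SelfMixingDichotomySequentialTypeIExclusionStubLerayHopfLocalEnergySolution
import Summits.NavierStokesRegularity.NavierStokesRegularity.Theorems.SelfMixingDichotomySequentialTypeIExclusionStubContinuationPastFinalTime
import Summits.NavierStokesRegularity.NavierStokesRegularity.Theorems.SelfMixingDichotomySequentialTypeIExclusionStubFinalTimeTypeISingularPoint
import Literature.Analysis.FluidPDE.PartialRegularity
import Literature.Analysis.FluidPDE.LocalEnergySolutionsOn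
import Literature.Analysis.FluidPDE.SereginSverakPressureProofs
import HarnessLib.Audit

/-!
# Skeleton of the crux `SelfMixingDichotomy.SequentialTypeIExclusion` — line `registered` (reshape r4)

(crux item `stmt-NavierStokesRegularity-1424`, rank 4, route `route-NavierStokesRegularity-SelfMixingDichotomy`;
tree path `Cruxes/SequentialTypeIExclusion/Lines/birth.lean`; birth registrar
`planner-skel-stmt-NavierStokesRegularity-1424-0`; reshapes r1/r2 by lead 0, r3 by lead c1, **r4 by the continuation
lead `prover-line-stmt-NavierStokesRegularity-1424-c2-0`, 2026-08-17** — see "Reshape r4" below; the r1–r3 history is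
kept verbatim in the tree's git history of this file and summarised at the end of this docstring;
continuation leads c3, c4, c5, c6, c7 kept r4 unchanged — see "State after continuation lead c7 / c6 / c5 / c4" below.)

THE CRUX (S1, "Type-I windows"). For every `M`, every classical Leray–Hopf solution `u` (ν = 1) on
`ℝ³ × [0,T)` from a rapidly decaying datum and every `x₀`: if the local Reynolds number
`C(r) = r⁻² ∬_{Q_r(T,x₀)} |u|³` (`Literature.Analysis.FluidPDE.cknC`, backward cylinders ending at `T`) satisfies
`C(r_k) ≤ M` along SOME sequence `r_k → 0` (liminf form), then `u` is bounded on some `(T−ρ²,T) × B_ρ(x₀)` (BDD).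

## State after continuation lead c7 (2026-08-17, `prover-line-stmt-NavierStokesRegularity-1424-c7-0`) — r4 UNCHANGED

Eighth lead; no reshape, no new sub-goal, no re-wave (both open stubs stub-blocked since c4's wave; re-verified). Delta
audit since c6 (18:38Z): item evidence/notes — nothing new; tree — no declaration concludes
`Literature.Analysis.FluidPDE.TypeISingularityExists` either way, no window-to-window (`cknC` gap) estimate beyond
p158624; TTRL library for both stubs — empty; route — OPEN rev 2, NOT restated (the planner has not acted on
`RESTATEMENT.md`). Presearch refresh (corpus hybrid + vsearch; galaxy rc 3 queue-saturated; arXiv/Crossref 2024–26):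
only new neighbour arXiv:2510.25448 (Hu–Zhang 2025, MHD analogue of Seregin's "one bounded scaled quantity ⇒ Type I"
— limsup-type, not liminf); Seregin's Lecture Notes 2nd ed. (2025) ch. 8 "Further Analysis of Potential Blowups"
requested (acq-07528). Verdict on the ITEM unchanged: `promote-stub` (NSI) — see `PROMOTE.md`, `HANDOFF.md`; a ninth
lead on `registered` before the planner acts (file the foreseen layer 2 = NSI item + S1_sup conditional on
`TypeISingularityExists`, or restate per `RESTATEMENT.md`) can only repeat this audit.

## State after continuation lead c6 (2026-08-17, `prover-line-stmt-NavierStokesRegularity-1424-c6-0`) — r4 UNCHANGED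

No reshape; both open stubs remain the two open problems (NSI; `¬ TypeISingularityExists`). What c6 added, OUTSIDE
the composition (registered sub-goals of the item, `--supports`, all ACCEPTED): the regime-I PULSATING KINEMATIC
WITNESS, files `Theorems/SelfMixingDichotomySequentialTypeIExclusionPulse{Amplitude,Energy,WindowCeiling,PeakFloor,
Unbounded,SmoothDivFree,Arith}.lean` (p172625, p172497, p172602, p172490, p172547, p172508, p172662; one stub-worker
each) and the assembly `…SequentialTypeIExclusionPulsatingWitness.lean` (p172850): `pulsating_kinematicWitness` — a
jointly smooth, divergence-free field on `[0,1) × ℝ³` of energy `≤ 32|B₁|` with ZERO datum, the self-similar swirling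
eddy of the sibling crux with a pulse-train amplitude `a = Σ' 2ᵐ φ((1−t)·2^{4m²})`, which at `(1,0)` has Type-I
WINDOWS `C(wₙ) ≤ 2048|B₁|` (`wₙ = 2^{−2n²}/4 → 0`) and peaks `C(pₙ) ≥ κ 8ⁿ` (`pₙ = 2^{−2n²}`) and is unbounded there;
hence `windowsForceTypeI_false_without_momentum` and `sequentialTypeIExclusion_false_without_momentum` (the open stub
NSI and the crux S1 VERBATIM with the Navier–Stokes class replaced by {smooth, div-free, bounded energy, decaying
datum} are FALSE) and `supForm_false_without_momentum` (S1_sup false kinematically even under a pointwise Type-I rate,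
by S2's exactly self-similar eddy p168379). With the refuter's Mutation2 (S1 false for Navier–Stokes solutions without
the energy class) this certifies that NSI / S1 / S1_sup need BOTH the momentum equation and the energy class. Verdict on
the ITEM unchanged: `promote-stub` (NSI); planner action = `RESTATEMENT.md` (see `PROMOTE.md`, `HANDOFF.md`).

## State after continuation lead c5 (2026-08-17, `prover-line-stmt-NavierStokesRegularity-1424-c5-0`) — r4 UNCHANGED

No reshape; both open stubs remain the two open problems (NSI; `¬ TypeISingularityExists`); no blind
re-wave (both stub-blocked by c4's wave; tree and ledger delta audited). What c5 added, OUTSIDE the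
composition (registered sub-goals of the item, `--supports`), is the position of S1's Type-I half
relative to the SHARED conjecture `¬ Literature.Analysis.FluidPDE.LocalTypeISingularityExists`
(Albritton–Barker's all-balls form, used by ≥ 4 other routes and refuted by (L) in tree), files
`Theorems/SelfMixingDichotomySequentialTypeIExclusionSupFormOfNoLocalTypeI{,RelRate}.lean`
(p168106, p168226): `supForm_of_not_localTypeISingularityExists_of_subballC` (S1_sup with the
centred cubic bound strengthened to a sub-ball/Morrey bound at the point follows from the shared
conjecture: zoom packaging `exists_zoom_suitableInBall` + `albrittonBarker2019_lemma_2_6_holds`),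
`supForm_of_not_localTypeISingularityExists_of_relTypeI` (S1_sup follows from the shared conjecture
at every point carrying a Type-I rate RELATIVE to the point, `max(‖x−x₀‖, √(T−t))‖u‖ ≤ K` nearby) and
the dichotomy `typeIISpikes_of_not_bdd_of_not_localTypeISingularityExists` (under the shared
conjecture, a centred-Type-I singular final-time point carries accumulating TYPE-II SPIKES: thin
super-Type-I bursts at regular points before `T`, invisible to the centred quantities). So the price
of hanging S1_sup on the shared conjecture instead of `¬ TypeISingularityExists` is exactly one extra
clause ("no Type-II spikes at centred-Type-I points"); see `RESTATEMENT.md` / `PROMOTE.md`.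

## State after continuation lead c4 (2026-08-17, `prover-line-stmt-NavierStokesRegularity-1424-c4-0`) — r4 UNCHANGED

No reshape: the composition below and its two OPEN stubs are exactly c2's r4 (re-registered by c3 and
c4). What c4 added, all OUTSIDE the composition (registered sub-goals of the item, `--supports`):
the SMALL-REYNOLDS-NUMBER corner that the crux's informal text calls known —
`…Registered.sequentialTypeIExclusion_of_small` (S1 verbatim for every `M ≤ ε₀`) and
`…Registered.windowsForceTypeI_of_small` (the open stub `stub_windowsForceTypeI` for `M ≤ ε₀`), file
`Theorems/SelfMixingDichotomySequentialTypeIExclusionSmallReynoldsCorner.lean`, both CONDITIONAL on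
the Literature named fact `Literature.Analysis.FluidPDE.kwon2023_velocity_epsilon_regularity`
(`Literature/Analysis/FluidPDE/PressureFreeEpsilonRegularity.lean`, filed by c4: Kwon, JDE 2023 =
arXiv:2104.03160, Thm. 1.4 — the pressure-FREE one-scale ε-regularity criterion for suitable weak
solutions, which the tree did not have; Wolf 2015 is the original). c4's wave on the two open stubs:
both `stub-blocked` (open problems; no ledger item carries `¬TypeISingularityExists`; audits in the
lead's folder). So the crux now reads: `M ≤ ε₀` KNOWN (modulo a published theorem); `M > ε₀` ⇔
no-scale-intermittency ∧ final-time centred Type-I exclusion, both open, the first NECESSARY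
(`sequentialTypeIExclusion_iff`). Route-level recommendation unchanged: c3's `RESTATEMENT.md`.

## Reshape r4 (continuation lead c2, 2026-08-17) — what changed and why

r3 had isolated the Type-I half of the crux as `stub_noTypeIBlowup` = Seregin's open question "does boundedness of
`g` allow blowups?" in the unit-cylinder/backward form of the named fact
`Seregin2020_axisymmetricSingularPoint_typeII` (minus axisymmetry). That statement is NOT a registered decl of the
tree, so reading S1 as a conditional bridge required the planner to file a NEW conjecture def
(`SereginTypeIBlowupExists`, prepared by c1). r4 removes that need: the Type-I half is now LITERALLY the negation of
the EXISTING registered conjecture decl `Literature.Analysis.FluidPDE.TypeISingularityExists`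
(`PartialRegularity.lean`: a suitable weak solution on an open space–time region with a CENTRED Type-I singular
point, `sup_{0<r<r₀} (A + C + D + E)(r, z) < ∞`, `z` INTERIOR). The geometric obstruction noted by c1 — S1's point
`(T, x₀)` sits on the FINAL slice of a solution living on `[0, T)`, while `TypeISingularityExists` wants an interior
point — is removed by KNOWN mathematics, split into three provable stubs:

* `stub_lerayHopfLocalEnergySolution` [M, KNOWN; CLOSED — LANDED p157188 — Seregin 2014 App. B §B.5 / Lemarié-Rieusset 2016 §14.9; the tree's
  `IsGlobalLerayHopf.isLocalEnergySolutionOn_of_suitable_of_eqOn` uses only `IsLerayHopfOn T`]: a classical solution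
  on `[0,T)` which is Leray–Hopf on `[0,T]` is, with the gauged pressure `q = p − (p(·,0) − p̃[u](0))`
  (`SereginSverak2002.isSuitableWeakSolutionOn_gauge_of_classical`, `lintegral_slab_gauged_pressure_lt_top`), a local
  energy solution on `ℝ³ × (0, T)` with datum `u 0` (`IsLocalEnergySolutionOn T 1 (u 0) u q`).
* `stub_continuationPastFinalTime` [S; CLOSED — LANDED p156995 after the lead's Literature generalisation p156682; KNOWN — Leray 1934 /
  Lemarié-Rieusset 2016 Thm 14.8 Step 2 / Seregin 2014 §B.5]: a local energy solution on `(0, T)` whose FINAL slice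
  `v T` has finite energy extends to a local energy solution on `(0, T + 1)` agreeing with it on `[0, T]`: restart a
  global weak Leray–Hopf + local energy solution from `v T` (`exists_isGlobalLerayHopf_and_isLocalEnergySolutionOn`;
  `v T` is weakly divergence-free by `IsLocalEnergySolutionOn.integral_inner_gradient_slice_eq_zero` at `t = T`) and
  concatenate AT THE FINAL SLICE (`IsLocalEnergySolutionOn.exists_extension_of_slice_of_le`, the `t₀ ≤ T` form of the
  tree's concatenation theorem, proposal p156682 of this lead: the junction needs only the weak continuity on the
  closed interval, the weak form and the local energy inequality AT the slice `T`, all in the class). No uniqueness.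
* `stub_finalTimeTypeISingularPoint` [M/L, KNOWN; CLOSED — LANDED p157669 — Seregin 2007 / 2020 "one scaled quantity bounded ⇒ all bounded",
  in tree as `Seregin2020.scaledEnergies_bounded_of_cknC_le`]: if such a continuation `(U, P)` of `(u, q)` exists on
  `(0, T')`, `T < T'`, then a centred cubic Type-I bound `C(r; T, x₀) ≤ M'` (`0 < r < r₁`) for `u` at a point where `u`
  is NOT bounded near `(T, x₀)` makes `(T, x₀)` a centred Type-I singular point of `(U, P)` on the open slab
  `(0, T') × ℝ³` (`IsTypeISingularPoint`): `U = u`, `P = q` below `T`; `D(r₀) < ∞` from `q ∈ L^{3/2}` of the slab,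
  `A, E` at one scale from the energy class, whence `Aₑₛₛ + E + C + D ≤ K` on `(0, r₀/2]`; the genuine `sup_t` in the
  accepted `cknA` equals the `esssup` below `T` by continuity of `u`; `E` is computed with the weak gradient of the
  continuation (any weak gradient works in Seregin's bound); not regular at `(T,x₀)` because an essential bound on a
  centred cylinder is a pointwise bound on its lower half by continuity (`SereginSverak2002.norm_le_of_ae_restrict_of_continuousOn`).
* `stub_noTypeISingularity` [XL, OPEN — the REGISTERED conjecture decl negated]: `¬ TypeISingularityExists`, i.e. no
  suitable weak solution has a centred Type-I singular interior point. This is Type-I exclusion in Seregin's sense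
  ("whether the boundedness of `g` allows blowups or not … is still open", Seregin arXiv:2304.04045 p. 3; 2402.13229
  p. 2; 2507.08733), of which the crux's sup-form is an instance (`TypeISingularityExists` is a registered OPEN
  existence question; its negation is the open Type-I exclusion statement every line of S1 contains). A planner can
  now read S1 as `--conditional-on TypeISingularityExists` WITHOUT filing anything new.
* `stub_windowsForceTypeI` [L, OPEN — UNCHANGED since birth; no literature]: Type-I windows at arbitrarily small
  scales force a centred cubic Type-I bound (no scale-intermittency). Provable corners landed: log-dense windows and
  `M ≤ 0` (`…Theorems.SequentialTypeIExclusion.Registered.windowsForceTypeI_logDense/_logDenseSeq/_nonpos`, p156105).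

`SequentialTypeIExclusion_of : SequentialTypeIExclusion` is the ONLY theorem of this file concluding the crux
(conclusion = the crux BY NAME, no `Prop` hypotheses, `sorry` only inside the two OPEN stubs `stub_windowsForceTypeI`, `stub_noTypeISingularity`; the three KNOWN stubs are landed and used by name):
windows ⇒ (stub_windowsForceTypeI) centred Type-I bound; if `u` is bounded near `(T,x₀)` we are done; otherwise
(stub_lerayHopfLocalEnergySolution, stub_continuationPastFinalTime) continue `u` past `T` and
(stub_finalTimeTypeISingularPoint) exhibit a centred Type-I singular point, contradicting stub_noTypeISingularity.
Hence, kernel-checked: **S1 ⇐ no-scale-intermittency ∧ ¬TypeISingularityExists**, with ALL glue LANDED (p157188, p156995, p157669; Literature p156682).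

What r4 drops from the skeleton (all LANDED, kept in the tree as `--supports` helpers of the item, and still a valid
alternative composition): r1's `stub_typeIWindowEpsilonRegularity` (p147358), r2's `stub_centredTypeITangentFlow`
(p149197) and the r3 glue `noCentredTypeITangentFlow_of_noTypeIBlowup` / `noTypeIBlowup_of_noCentredTypeITangentFlow`
(p153495: over the tree, "no centred Type-I tangent flow" ⇔ "no Type I blowup in Seregin's unit-cylinder sense").
r3's open `stub_noTypeIBlowup` (unit-cylinder form) and r4's `stub_noTypeISingularity` (interior form) are two
phrasings of the same open problem; r4's is the tree's registered one.

## History (r1–r3, leads 0 and c1, 2026-08-17) — one line each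
r1: birth stub 1 (velocity-only one-scale ε-regularity, Wolf) not derivable from the tree (no local pressure
projection) → replaced by ε-regularity under a Type-I bound, landed p147358. r2: birth stub 3 (Type-I bound ⇒ deep
windows) cut into tangent-flow extraction (landed p149197) + tangent-flow rigidity (open). r3: rigidity rephrased as
Seregin's "no Type I blowup" (open, = named fact minus axisymmetry), equivalence glue landed p153495.
-/

noncomputable section

open Set MeasureTheory Filter Topology Metric
open scoped ENNReal NNReal

namespace Summit.NavierStokesRegularity.NavierStokesRegularity.Cruxes.SequentialTypeIExclusion.Birth

set_option linter.unusedVariables false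
set_option linter.dupNamespace false

/-- **stub 2 — `stub_windowsForceTypeI` (L; OPEN — the content specific to the liminf form of the crux;
unchanged from birth).** Type-I windows at arbitrarily small scales force a centred cubic Type-I bound: for
every classical Leray–Hopf solution (ν = 1) from a rapidly decaying datum and every `x₀`,
`liminf_{r→0} C(r; T, x₀) ≤ M` implies `C(r; T, x₀) ≤ M'` for all `0 < r < r₁`, for some `M'`, `r₁ > 0`
(no scale-intermittency between Type-I windows and unbounded-Reynolds bursts). Provable corners (log-dense
windows, `M ≤ 0`) are landed as `…Registered.windowsForceTypeI_logDense / _logDenseSeq / _nonpos`; the open content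
is the case of SPARSE windows `r_k / r_{k+1} → ∞`, `M > 0`. -/
theorem stub_windowsForceTypeI :
    ∀ M : ℝ, ∀ T : ℝ, 0 < T →
      ∀ (u : ℝ → EuclideanSpace ℝ (Fin 3) → EuclideanSpace ℝ (Fin 3))
        (p : ℝ → EuclideanSpace ℝ (Fin 3) → ℝ),
        Literature.Analysis.FluidPDE.IsClassicalNSSolutionOn (Set.Ico 0 T) 1 0 u p →
        Literature.Analysis.FluidPDE.IsLerayHopfOn T 1 0 (u 0) u →
        Literature.Analysis.FluidPDE.HasRapidSpatialDecay (u 0) →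
        ∀ x₀ : EuclideanSpace ℝ (Fin 3),
          (∀ r₀ : ℝ, 0 < r₀ → ∃ r ∈ Set.Ioo 0 r₀,
            Literature.Analysis.FluidPDE.cknC r ((T, x₀) : ℝ × EuclideanSpace ℝ (Fin 3)) u ≤ ENNReal.ofReal M) →
          ∃ M' : ℝ, ∃ r₁ : ℝ, 0 < r₁ ∧ ∀ r ∈ Set.Ioo 0 r₁,
            Literature.Analysis.FluidPDE.cknC r ((T, x₀) : ℝ × EuclideanSpace ℝ (Fin 3)) u ≤ ENNReal.ofReal M' := by
  sorry

/-- **stub 3 (r4) — `stub_lerayHopfLocalEnergySolution` (M; CLOSED: LANDED p157188 as `…Theorems.SequentialTypeIExclusion.Registered.stub_lerayHopfLocalEnergySolution`; KNOWN: Leray–Hopf solutions which are suitable on the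
strip are local energy solutions — Seregin 2014, App. B Def. B.1 & §B.5; Lemarié-Rieusset 2016, §14.9; the tree's
`IsGlobalLerayHopf.isLocalEnergySolutionOn_of_suitable_of_eqOn` uses of the global class only its restriction
`IsLerayHopfOn T`).** A classical solution of Navier–Stokes (ν = 1, no force) on `ℝ³ × [0, T)` which is a Leray–Hopf
weak solution on `[0, T]` is, together with the gauged pressure `q(t, x) = p(t, x) − (p(t, 0) − p̃[u(t)](0))`
(`SereginSverak2002.isSuitableWeakSolutionOn_gauge_of_classical`: suitable on the open strip;
`SereginSverak2002.lintegral_slab_gauged_pressure_lt_top`: `q ∈ L^{3/2}((0,T) × ℝ³)`), a local energy solution on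
`ℝ³ × (0, T)` with datum `u 0` in the sense of Seregin 2014, Def. B.1 (`IsLocalEnergySolutionOn`). -/
theorem stub_lerayHopfLocalEnergySolution :
    ∀ T : ℝ, 0 < T →
      ∀ (u : ℝ → EuclideanSpace ℝ (Fin 3) → EuclideanSpace ℝ (Fin 3))
        (p : ℝ → EuclideanSpace ℝ (Fin 3) → ℝ),
        Literature.Analysis.FluidPDE.IsClassicalNSSolutionOn (Set.Ico 0 T) 1 0 u p →
        Literature.Analysis.FluidPDE.IsLerayHopfOn T 1 0 (u 0) u →
        Literature.Analysis.FluidPDE.IsLocalEnergySolutionOn T 1 (u 0) u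
          (fun t x => p t x - (p t 0 - Literature.Analysis.FluidPDE.normalisedPressure (u t) 0)) :=
  Summit.NavierStokesRegularity.NavierStokesRegularity.Theorems.SequentialTypeIExclusion.Registered.stub_lerayHopfLocalEnergySolution

/-- **stub 4 (r4) — `stub_continuationPastFinalTime` (S; CLOSED: LANDED p156995 as `…Registered.stub_continuationPastFinalTime`,
using the `t₀ ≤ T` concatenation theorem p156682; KNOWN: Leray 1934 weak continuation; Lemarié-Rieusset 2016 Thm. 14.8 proof Step 2; Seregin 2014 App. B §B.5).**
A local energy solution `(v, π)` on `ℝ³ × (0, T)` (ν = 1) whose final slice `v T` has finite energy extends to a local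
energy solution `(U, P)` on `ℝ³ × (0, T + 1)` with the same datum which agrees with `(v, π)` on `[0, T]`: restart a
global weak Leray–Hopf + local energy solution from the weakly divergence-free final slice
(`exists_isGlobalLerayHopf_and_isLocalEnergySolutionOn`, `IsLocalEnergySolutionOn.integral_inner_gradient_slice_eq_zero`
at `t = T`) and concatenate at the final slice (`IsLocalEnergySolutionOn.exists_extension_of_slice_of_le`). -/
theorem stub_continuationPastFinalTime :
    ∀ T : ℝ, 0 < T →
      ∀ (v₀ : EuclideanSpace ℝ (Fin 3) → EuclideanSpace ℝ (Fin 3))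
        (v : ℝ → EuclideanSpace ℝ (Fin 3) → EuclideanSpace ℝ (Fin 3))
        (π : ℝ → EuclideanSpace ℝ (Fin 3) → ℝ),
        Literature.Analysis.FluidPDE.IsLocalEnergySolutionOn T 1 v₀ v π →
        MeasureTheory.MemLp (v T) 2 MeasureTheory.volume →
        ∃ (U : ℝ → EuclideanSpace ℝ (Fin 3) → EuclideanSpace ℝ (Fin 3))
          (P : ℝ → EuclideanSpace ℝ (Fin 3) → ℝ),
          Literature.Analysis.FluidPDE.IsLocalEnergySolutionOn (T + 1) 1 v₀ U P ∧
          ∀ t ∈ Set.Icc 0 T, U t = v t ∧ P t = π t :=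
  Summit.NavierStokesRegularity.NavierStokesRegularity.Theorems.SequentialTypeIExclusion.Registered.stub_continuationPastFinalTime

/-- **stub 5 (r4) — `stub_finalTimeTypeISingularPoint` (M/L; CLOSED: LANDED p157669 as `…Registered.stub_finalTimeTypeISingularPoint`, 312 lines; KNOWN: "one scaled energy quantity bounded ⇒ all
bounded", Seregin 2007 / Seregin 2020 §2, in tree as `Seregin2020.scaledEnergies_bounded_of_cknC_le`; regular points
are points of essential boundedness, CKN 1982 §6).** Let `u` be a classical solution on `ℝ³ × [0,T)` (ν = 1), Leray–Hopf
on `[0,T]`, and let `(U, P)` be a local energy solution on `ℝ³ × (0, T')`, `T < T'`, agreeing on `[0, T]` with `u` and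
its gauged pressure `q`. If `C(r; T, x₀) ≤ M'` for `0 < r < r₁` (centred cubic Type-I bound for `u`) and `u` is NOT
bounded on any `(T − ρ², T) × B_ρ(x₀)`, then `(T, x₀)` is a centred Type-I singular point of `(U, P)` on the open slab
`(0, T') × ℝ³` (`IsTypeISingularPoint`: suitable there; `(T,x₀)` interior and not regular — an essential bound on a
centred cylinder bounds `u` pointwise on its lower half by continuity; a weak spatial gradient `G` of `U` on the slab;
and `sup_{0<r<r₀} (A + C + D + E)(r; T, x₀) < ∞` — backward cylinders, where `U = u`, `P = q`: `D(r₀) < ∞` from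
`q ∈ L^{3/2}((0,T) × ℝ³)`, Seregin's bound gives `Aₑₛₛ + E + C + D ≤ K` on `(0, r₀/2]`, and the accepted `sup_t`
quantity `cknA` equals `cknAEss` below `T` because `t ↦ ∫_{B_r} |u(t)|²` is continuous on `(T − r², T)`). -/
theorem stub_finalTimeTypeISingularPoint :
    ∀ M' T T' : ℝ, 0 < T → T < T' →
      ∀ (u : ℝ → EuclideanSpace ℝ (Fin 3) → EuclideanSpace ℝ (Fin 3))
        (p : ℝ → EuclideanSpace ℝ (Fin 3) → ℝ)
        (U : ℝ → EuclideanSpace ℝ (Fin 3) → EuclideanSpace ℝ (Fin 3))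
        (P : ℝ → EuclideanSpace ℝ (Fin 3) → ℝ),
        Literature.Analysis.FluidPDE.IsClassicalNSSolutionOn (Set.Ico 0 T) 1 0 u p →
        Literature.Analysis.FluidPDE.IsLerayHopfOn T 1 0 (u 0) u →
        Literature.Analysis.FluidPDE.IsLocalEnergySolutionOn T' 1 (u 0) U P →
        (∀ t ∈ Set.Icc 0 T, U t = u t ∧
          P t = fun x => p t x - (p t 0 - Literature.Analysis.FluidPDE.normalisedPressure (u t) 0)) →
        ∀ x₀ : EuclideanSpace ℝ (Fin 3),
          (∃ r₁ : ℝ, 0 < r₁ ∧ ∀ r ∈ Set.Ioo 0 r₁,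
            Literature.Analysis.FluidPDE.cknC r ((T, x₀) : ℝ × EuclideanSpace ℝ (Fin 3)) u ≤ ENNReal.ofReal M') →
          (¬ ∃ ρ : ℝ, 0 < ρ ∧ ∃ M : ℝ, ∀ t ∈ Set.Ioo (T - ρ ^ 2) T, ∀ x ∈ Metric.ball x₀ ρ, ‖u t x‖ ≤ M) →
          Literature.Analysis.FluidPDE.IsTypeISingularPoint
            (Literature.Analysis.FluidPDE.slab (EuclideanSpace ℝ (Fin 3)) (Set.Ioo 0 T') isOpen_Ioo)
            U P ((T, x₀) : ℝ × EuclideanSpace ℝ (Fin 3)) :=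
  Summit.NavierStokesRegularity.NavierStokesRegularity.Theorems.SequentialTypeIExclusion.Registered.stub_finalTimeTypeISingularPoint

/-- **stub 6 (r4) — `stub_noTypeISingularity` (XL; OPEN — the REGISTERED conjecture decl
`Literature.Analysis.FluidPDE.TypeISingularityExists` NEGATED).** No suitable weak solution of Navier–Stokes (ν = 1,
no force) on an open space–time region has a centred Type-I singular interior point (`sup_{0<r<r₀} (A + C + D + E) < ∞`
at a point of the singular set). This is centred Type-I exclusion in the sense of Seregin–Šverák 2009 §1 / Seregin
2020, stated OPEN by Seregin (arXiv:2304.04045 = CPAA 2024, p. 3: "The question about Type I blowups is whether the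
boundedness of `g` allows blowups or not. It is still open."; arXiv:2402.13229 p. 2; arXiv:2507.08733); known
sub-classes: axisymmetric (Seregin 2020, named fact `Seregin2020_axisymmetricSingularPoint_typeII`), backward
self-similar (NRŠ 1996 / Tsai 1998), λ-DSS with λ ≈ 1 (Chae–Wolf 2017); not implied by the KNSS Liouville
conjecture `LiouvilleConjectureNS` as filed (Albritton–Barker 2019 Thm 1.1 needs the all-sub-balls bound, the tree's
`LocalTypeISingularityExists`). The crux's sup-form is an instance, so every line of S1 contains it. -/
theorem stub_noTypeISingularity : ¬ Literature.Analysis.FluidPDE.TypeISingularityExists := by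
  sorry

/-- **Composition (the skeleton theorem, r4).** The crux BY NAME from the registered stubs, used by name: the centred
Type-I bound from `stub_windowsForceTypeI`; if `u` is bounded near `(T, x₀)` there is nothing to prove; otherwise
`u` with its gauged pressure is a local energy solution on `(0, T)` (`stub_lerayHopfLocalEnergySolution`), its final
slice `u T` has finite energy (Leray–Hopf class on the closed interval), so it continues to `(0, T + 1)`
(`stub_continuationPastFinalTime`), and `(T, x₀)` is a centred Type-I singular interior point of the continuation
(`stub_finalTimeTypeISingularPoint`) — contradicting `stub_noTypeISingularity`. -/
theorem SequentialTypeIExclusion_of : Theses.SelfMixingDichotomy.SequentialTypeIExclusion := by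
  have hwin := stub_windowsForceTypeI
  have hloc := stub_lerayHopfLocalEnergySolution
  have hcont := stub_continuationPastFinalTime
  have hpt := stub_finalTimeTypeISingularPoint
  have hno := stub_noTypeISingularity
  intro M T hT u p hcl hLH hdec x₀ hlim
  -- stub 2: Type-I windows at arbitrarily small scales force a centred cubic Type-I bound
  obtain ⟨M', r₁, hr₁, hTI⟩ := hwin M T hT u p hcl hLH hdec x₀ hlim
  by_contra hB
  -- stub 3: `(u, q)` is a local energy solution on `(0, T)`
  have hv := hloc T hT u p hcl hLH
  -- the final slice has finite energy
  have hmem : MeasureTheory.MemLp (u T) 2 MeasureTheory.volume := hLH.memLp T ⟨hT.le, le_rfl⟩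
  -- stub 4: continuation past `T`
  obtain ⟨U, P, hU, hagree⟩ := hcont T hT (u 0) u _ hv hmem
  -- stub 5: `(T, x₀)` is a centred Type-I singular interior point of the continuation
  have hsing := hpt M' T (T + 1) hT (by linarith) u p U P hcl hLH hU hagree x₀ ⟨r₁, hr₁, hTI⟩ hB
  -- stub 6: no such point exists
  exact hno ⟨_, U, P, _, hsing⟩

end Summit.NavierStokesRegularity.NavierStokesRegularity.Cruxes.SequentialTypeIExclusion.Birth
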